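import Summits.Ventures.PercRepro.RankLevelSetHallLostInjLevel

/-!
# PercRepro — THE CYCLIC-PART REDUCTION WITH THE TRUE SOURCE SET: `(INJ)` FROM INJECTIONS OF THE COLOOP PARTS OF THE LOST
SETS OF EACH CYCLIC SET INTO THEIR INDEPENDENT SUPERSETS OVER ITS CLOSURE (p4, gen 34; C-044, UP form at the tight layer;
paper proofs/P4-CELL-THREE.md §14.22 (i)–(k))

`RankLevelSetHallLostInjLevel` reduces `(INJ)` to a family of level injections whose SOURCES were described by a
coindependence condition on the contraction `M / cl C`; that description is strictly weaker than what a lost set gives —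
the member condition forces `(E ∖ cl C) ∖ K` to be independent and `#cl C = 2 r(C)` — and as a hypothesis it is too
strong to hold in general (U_{4,8} ⊕ 3 parallel pairs has more coindependent independent 5-sets than independent 6-sets).
Here the same map `S = C ⊔ K ↦ C ∪ ψ C (#K) (p − #S) K` is shown to be an injection under the EXACT hypothesis: for every
CYCLIC set `C` (every `x ∈ C` lies in `cl(C ∖ x)`), an injection `ψ C i d` from the coloop parts `K` of the lost sets
`C ⊔ K` (`K ⊆ E ∖ cl C`, `#K = i`, `r(C ∪ K) = r C + i`, `C ∪ K` lost, `#(C ∪ K) + d = p`) into the `(i + d)`-sets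
`K' ⊇ K` independent over `cl C` — i.e. the max-rank form of `(INJ)` restricted to one cyclic part, which holds on every
matroid with `≤ 8` elements and on 12,307 block-model cells up to `n = 72`.  The cyclic part of a lost set is cyclic
(`mem_closure_sdiff_of_mem_cyclicPart`: an element of `C` in the closure of `S ∖ x` is in the closure of `C ∖ x`, because
the coloops `K` are independent over `cl C`).
* `mem_closure_sdiff_of_mem_cyclicPart`;
* **`lostInj_of_cyclicInj`** — the reduction with the true source set.
Axioms: standard.
-/

namespace PercRepro

open Set Matroid

variable {α : Type} (M : Matroid α) [M.Finite]

omit [M.Finite] in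
/-- An element of the cyclic part `C` of `S = C ∪ K` (`x ∈ cl(S ∖ x)`) lies in the closure of `C ∖ x` when the coloops
`K` are independent over `cl C`: otherwise `r(C) = r(C ∖ x) + 1` and `r((C ∖ x) ∪ K) ≤ r(C ∖ x) + #K < r(C ∪ K)`. -/
theorem mem_closure_sdiff_of_mem_cyclicPart {C K : Set α} (hKfin : K.Finite)
    (hCK : M.eRk (C ∪ K) = M.eRk C + K.ncard) (hCtop : M.eRk C ≠ ⊤) {x : α} (hxC : x ∈ C)
    (hx : x ∈ M.closure ((C ∪ K) \ {x})) : x ∈ M.closure (C \ {x}) := by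
  by_contra hnot
  have hxE : x ∈ M.E := (M.closure_subset_ground _) hx
  -- `r(C) = r(C ∖ x) + 1`
  have h1 : M.eRk C = M.eRk (C \ {x}) + 1 := by
    rw [← eRk_insert_eq_add_one ⟨hxE, hnot⟩, insert_sdiff_singleton, insert_eq_of_mem hxC]
  -- `r(C ∪ K) = r((C ∪ K) ∖ x)`
  have h2 : M.eRk ((C ∪ K) \ {x}) = M.eRk (C ∪ K) := eRk_sdiff_singleton_eq_of_mem_closure M (Or.inl hxC) hx
  -- `(C ∪ K) ∖ x ⊆ (C ∖ x) ∪ K`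
  have h3 : M.eRk ((C ∪ K) \ {x}) ≤ M.eRk ((C \ {x}) ∪ K) := by
    refine M.eRk_mono ?_
    intro y hy
    rcases hy.1 with hyC | hyK
    · exact Or.inl ⟨hyC, hy.2⟩
    · exact Or.inr hyK
  have h4 : M.eRk ((C \ {x}) ∪ K) ≤ M.eRk (C \ {x}) + K.encard := M.eRk_union_le_eRk_add_encard _ _
  rw [← hKfin.cast_ncard_eq] at h4
  -- assemble: `r(C ∖ x) + 1 + #K ≤ r(C ∖ x) + #K`
  have hCx : M.eRk (C \ {x}) ≠ ⊤ := fun h => hCtop (by rw [h1, h, top_add])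
  obtain ⟨c, hc⟩ : ∃ c : ℕ, M.eRk (C \ {x}) = c := ⟨_, (ENat.coe_toNat hCx).symm⟩
  rw [h2, hCK, h1, hc] at h3
  rw [hc] at h4
  have h5 := h3.trans h4
  rw [← Nat.cast_one, ← Nat.cast_add, ← Nat.cast_add, ← Nat.cast_add] at h5
  have h6 : c + 1 + K.ncard ≤ c + K.ncard := by exact_mod_cast h5
  omega

/-- **The cyclic-part reduction of (INJ) with the true source set**: for every CYCLIC set `C`, an injection `ψ C i d` from
the coloop parts `K` of the lost sets `C ⊔ K` (`K ⊆ E ∖ cl C`, `#K = i`, `r(C ∪ K) = r C + i`, `C ∪ K` lost,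
`#(C ∪ K) + d = p`) into the `(i + d)`-sets `K' ⊇ K` independent over `cl C` gives `LostInj M p q`: the lost set
`S = C ⊔ K` goes to `C ∪ ψ C (#K) (p − #S) K` (no tight-layer hypothesis is needed for this step). -/
theorem lostInj_of_cyclicInj {p q : ℕ} (ψ : Set α → ℕ → ℕ → Set α → Set α)
    (hψ : ∀ (C : Set α) (i d : ℕ), C ⊆ M.E → (∀ x ∈ C, x ∈ M.closure (C \ {x})) → 1 ≤ d →
      (∀ K, K ⊆ M.E \ M.closure C → K.ncard = i → M.eRk (C ∪ K) = M.eRk C + i →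
        C ∪ K ∈ lostSets M p q → (C ∪ K).ncard + d = p →
        ψ C i d K ⊆ M.E \ M.closure C ∧ (ψ C i d K).ncard = i + d ∧
          M.eRk (C ∪ ψ C i d K) = M.eRk C + ((i + d : ℕ) : ℕ∞) ∧ K ⊆ ψ C i d K) ∧
      Set.InjOn (ψ C i d) {K | K ⊆ M.E \ M.closure C ∧ K.ncard = i ∧ M.eRk (C ∪ K) = M.eRk C + i ∧
        C ∪ K ∈ lostSets M p q ∧ (C ∪ K).ncard + d = p}) :
    LostInj M p q := by
  classical
  have hEfin : M.E.Finite := M.set_finite M.E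
  -- the data of a lost set: cyclic part `C`, coloops `K`, and the properties used by the map and by injectivity
  have key : ∀ S ∈ lostSets M p q,
      let C := {x ∈ S | x ∈ M.closure (S \ {x})}
      let K := S \ C
      C ⊆ M.E ∧ 1 ≤ p - S.ncard ∧ K ⊆ M.E \ M.closure C ∧ M.eRk (C ∪ K) = M.eRk C + K.ncard ∧
        (∀ x ∈ C, x ∈ M.closure (C \ {x})) ∧ C ∪ K ∈ lostSets M p q ∧ (C ∪ K).ncard + (p - S.ncard) = p ∧
        M.eRk C + K.ncard = (q : ℕ∞) ∧ C.ncard + K.ncard = S.ncard := by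
    intro S hS
    obtain ⟨hSE, hSq, hqS, hSp, Z, hZ, hZS⟩ := hS
    intro C K
    have hCS : C ⊆ S := fun x hx => hx.1
    have hKS : K ⊆ S := sdiff_subset
    have hCE : C ⊆ M.E := hCS.trans hSE
    have hSfin : S.Finite := hEfin.subset hSE
    have hKfin : K.Finite := hSfin.subset hKS
    have hCfin : C.Finite := hSfin.subset hCS
    have hKcl : ∀ x ∈ K, x ∉ M.closure (S \ {x}) := fun x hx h => hx.2 ⟨hx.1, h⟩
    have hSK : S \ K = C := by
      ext x
      simp only [K, mem_sdiff, not_and, not_not]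
      constructor
      · rintro ⟨hxS, h⟩; exact h hxS
      · intro hxC; exact ⟨hCS hxC, fun _ => hxC⟩
    have hrank : M.eRk S = M.eRk C + K.ncard := by
      have := eRk_eq_eRk_sdiff_add_ncard M hSE K hKS hKcl
      rwa [hSK] at this
    have hCK : C ∪ K = S := by
      rw [← hSK, sdiff_union_of_subset hKS]
    have hKE : K ⊆ M.E \ M.closure C := by
      intro x hx
      refine ⟨hSE (hKS hx), fun h => hKcl x hx (M.closure_subset_closure ?_ h)⟩
      intro y hy
      refine ⟨hCS hy, fun h' => ?_⟩
      rw [mem_singleton_iff] at h'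
      exact hx.2 (h' ▸ hy)
    have hq : M.eRk C + K.ncard = (q : ℕ∞) := by rw [← hrank, hSq]
    have hcard : C.ncard + K.ncard = S.ncard := by
      rw [← hCK, ncard_union_eq ?_ hCfin hKfin]
      exact disjoint_left.2 (fun x hxC hxK => hxK.2 hxC)
    -- the rank of `C` as a natural number
    have hCtop : M.eRk C ≠ ⊤ := ((M.eRk_le_encard C).trans_lt hCfin.encard_lt_top).ne
    obtain ⟨c, hc⟩ : ∃ c : ℕ, M.eRk C = c := ⟨(M.eRk C).toNat, (ENat.coe_toNat hCtop).symm⟩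
    have hcq : c + K.ncard = q := by
      have : ((c + K.ncard : ℕ) : ℕ∞) = (q : ℕ∞) := by rw [Nat.cast_add, ← hc, hq]
      exact_mod_cast this
    -- the cyclic part is cyclic
    have hcyc : ∀ x ∈ C, x ∈ M.closure (C \ {x}) := fun x hx =>
      mem_closure_sdiff_of_mem_cyclicPart M hKfin (by rw [hCK, hrank]) hCtop hx (by rw [hCK]; exact hx.2)
    have hlost : C ∪ K ∈ lostSets M p q := by rw [hCK]; exact ⟨hSE, hSq, hqS, hSp, Z, hZ, hZS⟩
    have hsize : (C ∪ K).ncard + (p - S.ncard) = p := by rw [hCK]; omega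
    exact ⟨hCE, by omega, hKE, by rw [hCK, hrank], hcyc, hlost, hsize, hq, hcard⟩
  -- the injection
  refine ⟨fun S => {x ∈ S | x ∈ M.closure (S \ {x})} ∪
      ψ {x ∈ S | x ∈ M.closure (S \ {x})} (S \ {x ∈ S | x ∈ M.closure (S \ {x})}).ncard (p - S.ncard)
        (S \ {x ∈ S | x ∈ M.closure (S \ {x})}), ?_, ?_⟩
  · intro S hS
    obtain ⟨hCE, hd, hKE, hCK, hcyc, hlost, hsize, hq, hcard⟩ := key S hS
    obtain ⟨hSE, hSq, hqS, hSp, -⟩ := hS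
    dsimp only
    set C := {x ∈ S | x ∈ M.closure (S \ {x})} with hCdef
    set K := S \ C with hKdef
    obtain ⟨hψE, hψcard, hψrk, hKψ⟩ := (hψ C K.ncard (p - S.ncard) hCE hcyc hd).1 K hKE rfl hCK hlost hsize
    have hCS : C ⊆ S := fun x hx => hx.1
    have hCKS : C ∪ K = S := by rw [hKdef, union_sdiff_cancel hCS]
    have hdisj : Disjoint C (ψ C K.ncard (p - S.ncard) K) :=
      disjoint_left.2 (fun x hxC hxψ => (hψE hxψ).2 (M.subset_closure C hCE hxC))
    have hCfin : C.Finite := hEfin.subset hCE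
    have hψfin : (ψ C K.ncard (p - S.ncard) K).Finite := hEfin.subset (hψE.trans sdiff_subset)
    have hCtop : M.eRk C ≠ ⊤ := ((M.eRk_le_encard C).trans_lt hCfin.encard_lt_top).ne
    obtain ⟨c, hc⟩ : ∃ c : ℕ, M.eRk C = c := ⟨(M.eRk C).toNat, (ENat.coe_toNat hCtop).symm⟩
    have hcq : c + K.ncard = q := by
      have : ((c + K.ncard : ℕ) : ℕ∞) = (q : ℕ∞) := by rw [Nat.cast_add, ← hc, hq]
      exact_mod_cast this
    refine ⟨⟨⟨union_subset hCE (hψE.trans sdiff_subset), ?_, ?_⟩, ?_⟩, ?_⟩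
    · -- `q < r(T)`
      rw [hψrk, hc, ← Nat.cast_add]
      exact_mod_cast (by omega : q < c + (K.ncard + (p - S.ncard)))
    · -- `r(T) < p`
      rw [hψrk, hc, ← Nat.cast_add]
      exact_mod_cast (by omega : c + (K.ncard + (p - S.ncard)) < p)
    · -- `#T ≥ p`
      rw [ncard_union_eq hdisj hCfin hψfin, hψcard]
      omega
    · -- `S ⊆ T`
      intro x hx
      rw [← hCKS] at hx
      rcases hx with h | h
      · exact Or.inl h
      · exact Or.inr (hKψ h)
  · intro S₁ hS₁ S₂ hS₂ heq
    simp only at heq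
    obtain ⟨hCE₁, hd₁, hKE₁, hCK₁, hcyc₁, hlost₁, hsize₁, hq₁, hcard₁⟩ := key S₁ hS₁
    obtain ⟨hCE₂, hd₂, hKE₂, hCK₂, hcyc₂, hlost₂, hsize₂, hq₂, hcard₂⟩ := key S₂ hS₂
    set C₁ := {x ∈ S₁ | x ∈ M.closure (S₁ \ {x})} with hC₁
    set K₁ := S₁ \ C₁ with hK₁
    set C₂ := {x ∈ S₂ | x ∈ M.closure (S₂ \ {x})} with hC₂
    set K₂ := S₂ \ C₂ with hK₂
    obtain ⟨hψE₁, hψcard₁, hψrk₁, hKψ₁⟩ := (hψ C₁ K₁.ncard (p - S₁.ncard) hCE₁ hcyc₁ hd₁).1 K₁ hKE₁ rfl hCK₁ hlost₁ hsize₁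
    obtain ⟨hψE₂, hψcard₂, hψrk₂, hKψ₂⟩ := (hψ C₂ K₂.ncard (p - S₂.ncard) hCE₂ hcyc₂ hd₂).1 K₂ hKE₂ rfl hCK₂ hlost₂ hsize₂
    set T := C₁ ∪ ψ C₁ K₁.ncard (p - S₁.ncard) K₁ with hT
    have hT₂ : T = C₂ ∪ ψ C₂ K₂.ncard (p - S₂.ncard) K₂ := heq
    -- the cyclic part of the target is the cyclic part of the source
    have cyc : ∀ (S : Set α), S ∈ lostSets M p q →
        let C := {x ∈ S | x ∈ M.closure (S \ {x})}
        let K := S \ C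
        ∀ ψK : Set α, ψK ⊆ M.E \ M.closure C → ψK.ncard = K.ncard + (p - S.ncard) →
          M.eRk (C ∪ ψK) = M.eRk C + ((K.ncard + (p - S.ncard) : ℕ) : ℕ∞) → K ⊆ ψK →
          {x ∈ C ∪ ψK | x ∈ M.closure ((C ∪ ψK) \ {x})} = C := by
      intro S hS C K ψK hψKE hψKcard hψKrk hKψK
      obtain ⟨hSE, -, -, -, -⟩ := hS
      have hCS : C ⊆ S := fun x hx => hx.1
      have hCE : C ⊆ M.E := hCS.trans hSE
      have hCfin : C.Finite := hEfin.subset hCE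
      have hψfin : ψK.Finite := hEfin.subset (hψKE.trans sdiff_subset)
      have hCKS : C ∪ K = S := by rw [union_sdiff_cancel hCS]
      ext x
      simp only [mem_setOf_eq]
      constructor
      · rintro ⟨hxT, hxcl⟩
        rcases hxT with hxC | hxψ
        · exact hxC
        · exfalso
          -- `x ∈ ψK` is a coloop of `C ∪ ψK`: removing it drops the rank
          have hxE : x ∈ M.E := (hψKE hxψ).1
          have h1 : M.eRk ((C ∪ ψK) \ {x}) = M.eRk (C ∪ ψK) :=
            eRk_sdiff_singleton_eq_of_mem_closure M (Or.inr hxψ) hxcl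
          have h2 : (C ∪ ψK) \ {x} = C ∪ (ψK \ {x}) := by
            rw [union_sdiff_distrib]
            congr 1
            rw [sdiff_eq_left]
            exact disjoint_singleton_right.2 (fun h => (hψKE hxψ).2 (M.subset_closure C hCE h))
          have h3 : M.eRk (C ∪ (ψK \ {x})) ≤ M.eRk C + (ψK \ {x}).encard := M.eRk_union_le_eRk_add_encard C _
          have h4 : (ψK \ {x}).encard = ((K.ncard + (p - S.ncard) - 1 : ℕ) : ℕ∞) := by
            rw [← (hψfin.subset sdiff_subset).cast_ncard_eq, ncard_sdiff_singleton_of_mem hxψ, hψKcard]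
          rw [h4] at h3
          rw [← h2, h1, hψKrk] at h3
          -- `r(C) + (m) ≤ r(C) + (m − 1)` with `m ≥ 1`
          have hCtop : M.eRk C ≠ ⊤ := ((M.eRk_le_encard C).trans_lt hCfin.encard_lt_top).ne
          obtain ⟨c, hc⟩ : ∃ c : ℕ, M.eRk C = c := ⟨(M.eRk C).toNat, (ENat.coe_toNat hCtop).symm⟩
          rw [hc, ← Nat.cast_add, ← Nat.cast_add] at h3
          have h5 : c + (K.ncard + (p - S.ncard)) ≤ c + (K.ncard + (p - S.ncard) - 1) := by exact_mod_cast h3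
          have hm : 1 ≤ K.ncard + (p - S.ncard) := by
            have : 0 < ψK.ncard := ncard_pos hψfin |>.2 ⟨x, hxψ⟩
            omega
          omega
      · intro hxC
        refine ⟨Or.inl hxC, ?_⟩
        refine M.closure_subset_closure ?_ hxC.2
        intro y hy
        refine ⟨?_, hy.2⟩
        have : y ∈ C ∪ K := by rw [hCKS]; exact hy.1
        rcases this with h | h
        · exact Or.inl h
        · exact Or.inr (hKψK h)
    have hcp₁ : {x ∈ T | x ∈ M.closure (T \ {x})} = C₁ := cyc S₁ hS₁ _ hψE₁ hψcard₁ hψrk₁ hKψ₁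
    have hcp₂ : {x ∈ T | x ∈ M.closure (T \ {x})} = C₂ := by
      rw [hT₂]
      exact cyc S₂ hS₂ _ hψE₂ hψcard₂ hψrk₂ hKψ₂
    have hC : C₁ = C₂ := hcp₁.symm.trans hcp₂
    -- the sizes of the coloop parts agree: `r(C) + #K = q`
    have hCtop : M.eRk C₁ ≠ ⊤ := ((M.eRk_le_encard C₁).trans_lt (hEfin.subset hCE₁).encard_lt_top).ne
    have hi : K₁.ncard = K₂.ncard := by
      have h := hq₁.trans hq₂.symm
      rw [← hC] at h
      have h' := WithTop.add_left_cancel hCtop h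
      exact Nat.cast_injective h'
    have hd : p - S₁.ncard = p - S₂.ncard := by
      have h1 := hcard₁; have h2 := hcard₂
      rw [hC] at h1
      omega
    -- the `ψ`-parts agree: both equal `T ∖ C`
    have hψeq : ψ C₁ K₁.ncard (p - S₁.ncard) K₁ = ψ C₂ K₂.ncard (p - S₂.ncard) K₂ := by
      have e1 : ψ C₁ K₁.ncard (p - S₁.ncard) K₁ = T \ C₁ := by
        rw [hT, union_sdiff_left]
        exact (sdiff_eq_left.2 (disjoint_left.2 (fun x hx hxC => (hψE₁ hx).2 (M.subset_closure C₁ hCE₁ hxC)))).symm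
      have e2 : ψ C₂ K₂.ncard (p - S₂.ncard) K₂ = T \ C₂ := by
        rw [hT₂, union_sdiff_left]
        exact (sdiff_eq_left.2 (disjoint_left.2 (fun x hx hxC => (hψE₂ hx).2 (M.subset_closure C₂ hCE₂ hxC)))).symm
      rw [e1, e2, hC]
    rw [hC, hi, hd] at hψeq
    have hK : K₁ = K₂ := by
      refine (hψ C₂ K₂.ncard (p - S₂.ncard) hCE₂ hcyc₂ hd₂).2 ?_ ⟨hKE₂, rfl, hCK₂, hlost₂, hsize₂⟩ hψeq
      rw [← hC]
      refine ⟨hKE₁, hi, ?_, hlost₁, ?_⟩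
      · rw [hCK₁, hi]
      · rw [← hd]; exact hsize₁
    -- `S = C ∪ K`
    have hS₁' : S₁ = C₁ ∪ K₁ := (union_sdiff_cancel (fun x hx => hx.1 : C₁ ⊆ S₁)).symm
    have hS₂' : S₂ = C₂ ∪ K₂ := (union_sdiff_cancel (fun x hx => hx.1 : C₂ ⊆ S₂)).symm
    rw [hS₁', hS₂', hC, hK]

end PercRepro
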